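import Summits.BirchSwinnertonDyer.BirchSwinnertonDyer.Theorems.Rank2Observatory2DescClCurveCertS
import Summits.BirchSwinnertonDyer.BirchSwinnertonDyer.Theorems.Rank2Observatory2DescClRealCertE
import HarnessLib

/-!
# BirchSwinnertonDyer — rank ≥ 2 observatory: KERNEL-2DESC-CL v3.0, S5 — the SPLIT-2 per-curve certificate (totally real case), part 1/2: records, checkers, entry lemmas

HONEST FRAMING: per-curve certified theorems and census instruments; no claim on BSD in rank ≥ 2.

The totally real (`Δ(F) > 0`, unit rank `2`) signature of the split-2 per-curve layer `…ClCurveCertS*`: exactly as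
v2.3's `…ClRealCertE2*` sits over `…ClCurveCertE2*`.  Every element-level lemma is the complex file's (`fracOf`,
`toInt`, `norm_eltS`, `rho_eltS`, `dispatch_soundS`, `supp_of_famCheckS`, `log_W₁/W₂_of_famCheckS`); specific here are
v2.1's archimedean layer (`ClFieldCertR.checkArch`: three isolating intervals, `exists_rho_of_arch`,
`units_rank_of_arch`), three sign rows read on `X = m₁x` (`m₁ > 0`), the `θ_E`-order of the places read on `X_t`,
and the three-place sieve `admStd3RQ`.  Records `ClFieldCertRS2` (= the v2.1 real `α`-record `fr` + split data +
`r₁`, with `toS2`), `ClCurveCertSR` (= `ClCurveCertS` + sign table at `ρ₁, ρ₂` + place order); checkers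
`famCheckSR`, `checkRS r`.  This part: records, checkers, entry-level real-place lemmas.  New declarations only.
Sorry-free; axioms `propext`, `Classical.choice`, `Quot.sound`.
[cite: Cassels1991LecturesEllipticCurves, §15] [cite: CremonaAlgorithms1997, §3.6] [cite: Cohen1993, §4.8.2, §6.5]
[cite: Marcus2018, Ch. 5, Thm. 38] [cite: SilvermanAEC2009, X.1.1]
-/

set_option linter.dupNamespace false

noncomputable section

open Polynomial NumberField IsDedekindDomain Module
open Literature.NumberTheory.NumberFields   -- OPENFIX (cert-1 gen 35): `MonicCubic.*` lives in this namespace; the line was missing (inlined-head prechecks leaked it from `…ClRealCertE`)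

namespace Summit.BirchSwinnertonDyer.BirchSwinnertonDyer.Rank2Observatory.TwoDescCl

open TwoDescCubic ClFieldCert

/-! ## Records -/

/-- **Totally real split-2 per-field record**: the v2.1 real `α`-record `fr` (registry core + three isolating
intervals), the split certificate, the class certificates at the primes above `2`, the fractional class certificates,
the discriminant helper, and `r₁` (`m₁ = r₁²`). Pure data. -/
structure ClFieldCertRS2 where
  fr : ClFieldCertR
  split : SplitTwo
  cls2 : Fin 3 → SplitTwo.ClassCertS
  clsA : List ClassCertA
  dh : FracElt
  pIrrS : ℕ
  r₁ : ℕ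

namespace ClFieldCertRS2

variable (G : ClFieldCertRS2)

/-- The signature-free split-2 record with multiplier underneath (all element lemmas of the complex files apply). -/
def toS2 : ClFieldCertS2 := ⟨⟨G.fr.core, G.split, G.cls2, G.clsA, G.dh, G.pIrrS⟩, G.r₁⟩

/-- **The per-field checker**: the archimedean clause of `fr`, the split core, the constant clause.
Computable; `decide +kernel` once per field. -/
def check2RS : Bool := G.fr.checkArch && (G.toS2.fs.checkCoreS && G.toS2.checkConst)

/-- The archimedean clause. -/
theorem checkArch_of_check2RS (h : G.check2RS = true) : G.fr.checkArch = true := by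
  simp only [check2RS, Bool.and_eq_true] at h; exact h.1

/-- The split core clause. -/
theorem coreS_of_check2RS (h : G.check2RS = true) : G.toS2.fs.checkCoreS = true := by
  simp only [check2RS, Bool.and_eq_true] at h; exact h.2.1

/-- The constant clause. -/
theorem const_of_check2RS (h : G.check2RS = true) : G.toS2.checkConst = true := by
  simp only [check2RS, Bool.and_eq_true] at h; exact h.2.2

/-- The `α`-view base of `toS2` is the v2.1 registry core (definitional). -/
theorem toS2_base : G.toS2.fs.base = G.fr.core := rfl

end ClFieldCertRS2

/-- **Totally real split-2 per-curve record**: the split-2 curve record `cc` (whose `head` lists the FIVE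
field-level family elements `−1, ε₁, ε₂, γ, q`), the sign bits at `ρ₁, ρ₂` of every family element keyed by its
`α`-view coordinates `X`, and the `θ_E`-order `o₀, o₁, o₂` of the places. -/
structure ClCurveCertSR where
  cc : ClCurveCertS
  sgn : List ((ℤ × ℤ × ℤ) × Bool × Bool)
  o₀ : Fin 3
  o₁ : Fin 3
  o₂ : Fin 3

namespace ClCurveCertSR

variable (ccr : ClCurveCertSR)

/-- Sign bit at `ρ₁` of the element with `α`-view coordinates `X` (table lookup; `false` if absent). -/
def sg₂ (X : ℤ × ℤ × ℤ) : Bool :=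
  match ccr.sgn.find? fun e => e.1 == X with
  | some e => e.2.1
  | none => false

/-- Sign bit at `ρ₂` of the element with `α`-view coordinates `X` (table lookup; `false` if absent). -/
def sg₃ (X : ℤ × ℤ × ℤ) : Bool :=
  match ccr.sgn.find? fun e => e.1 == X with
  | some e => e.2.2
  | none => false

end ClCurveCertSR

/-! ## Checkers -/

section Checkers

variable (G : ClFieldCertRS2) (ccr : ClCurveCertSR)

/-- **Family-entry checker (totally real)**: the complex split-2 clause (`famCheckS`, whose sign clause is the one at
`ρ₀`) and the sign clauses at `ρ₁`, `ρ₂`, all read on `X = m₁·x`. -/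
def famCheckSR (f : FamEntryS) : Bool :=
  famCheckS G.toS2 ccr.cc f &&
    signCond G.fr.lo₂ G.fr.hi₂ f.X (ccr.sg₂ f.X) &&
    signCond G.fr.lo₃ G.fr.hi₃ f.X (ccr.sg₃ f.X)

/-- Sign bit of the entry `f` at place `k`. -/
def sgAtS (f : FamEntryS) (k : Fin 3) : Bool :=
  if k = 0 then f.sg else if k = 1 then ccr.sg₂ f.X else ccr.sg₃ f.X

/-- Row `k` of the parity matrix at the entry `f`: `0, 1, 2` the signs at `ρ₀, ρ₁, ρ₂`, `3` parity of `ord_{W₁}`,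
`4` parity of `ord_{W₂}`, `5 + i` the Euler bit of the `i`-th residue character (all on `X`). -/
def bitRowRS (fc : ClFieldCert) (f : FamEntryS) : ℕ → Bool
  | 0 => f.sg
  | 1 => ccr.sg₂ f.X
  | 2 => ccr.sg₃ f.X
  | 3 => !decide ((2 : ℤ) ∣ famL₁S f)
  | 4 => !decide ((2 : ℤ) ∣ famL₂S f)
  | k + 5 => eulerBit (fc.chars.getD k (3, 0, 0)).1 (evalInt (fc.chars.getD k (3, 0, 0)).2.1 f.X)

/-- The parity matrix. -/
def bitRS (k : Fin (G.toS2.fs.base.chars.length + 5)) (j : Fin (famS ccr.cc).length) : Bool :=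
  bitRowRS ccr G.toS2.fs.base ((famS ccr.cc).get j) k

/-- **The sieve** on pairs `(T, U)` (`T = ∅`): norm-square residues modulo `Q` and the three-real-place sign
conditions in `θ_E`-order (`admStd3RQ`, norms `N(X)/m₁³`), parities of `ord_{W₁}`, `ord_{W₂}`. -/
def admRS (T : Finset (Fin 0)) (U : Finset (Fin (famS ccr.cc).length)) : Bool :=
  admStd3RQ ccr.cc.Q (fun i : Fin 0 => i.elim0) (famNormS G.toS2 ccr.cc) (fun i : Fin 0 => i.elim0)
      (fun i : Fin 0 => i.elim0) (fun i : Fin 0 => i.elim0)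
      (fun j => sgAtS ccr ((famS ccr.cc).get j) ccr.o₀) (fun j => sgAtS ccr ((famS ccr.cc).get j) ccr.o₁)
      (fun j => sgAtS ccr ((famS ccr.cc).get j) ccr.o₂) T U &&
    decide (Even (U.filter fun j => bitRowRS ccr G.toS2.fs.base ((famS ccr.cc).get j) 3 = true).card) &&
    decide (Even (U.filter fun j => bitRowRS ccr G.toS2.fs.base ((famS ccr.cc).get j) 4 = true).card)

/-- **The totally real split-2 per-curve checker for `rank ≤ r`**: the clauses of the complex checker `checkS`
with `Δ(F) > 0`, a head of FIVE field-level elements, the three-sign family clause, the `θ_E`-order of the places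
read on `X_t`, the parity certificate with `chars.length + 5` rows, and the count of sieve survivors `≤ 2 ^ r`.
Computable. -/
def checkRS (r : ℕ) : Bool :=
  decide (deltaShort ccr.cc.A ccr.cc.B ccr.cc.C ≠ 0) &&
    noRootMod ccr.cc.pF ccr.cc.A ccr.cc.B ccr.cc.C &&
    decide (cubicAtCoords G.toS2.fs.base.a G.toS2.fs.base.b G.toS2.fs.base.c ((G.toS2.m₁ : ℤ) * ccr.cc.A)
      ((G.toS2.m₁ : ℤ) ^ 2 * ccr.cc.B) ((G.toS2.m₁ : ℤ) ^ 3 * ccr.cc.C) ccr.cc.Xt = (0, 0, 0)) &&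
    decide (derivAtCoords G.toS2.fs.base.a G.toS2.fs.base.b G.toS2.fs.base.c ((G.toS2.m₁ : ℤ) * ccr.cc.A)
      ((G.toS2.m₁ : ℤ) ^ 2 * ccr.cc.B) ccr.cc.Xt =
      MonicCubic.mulCoords G.toS2.fs.base.a G.toS2.fs.base.b G.toS2.fs.base.c
        (smulCoords (G.toS2.m₁ : ℤ) ccr.cc.XD)
        (prodPowCoords G.toS2.fs.base.a G.toS2.fs.base.b G.toS2.fs.base.c [])) &&
    (fracOf G.toS2 ccr.cc.Xt ccr.cc.tsnT).check G.toS2.fs.base.a G.toS2.fs.base.b G.toS2.fs.base.c &&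
    (fracOf G.toS2 ccr.cc.XD ccr.cc.tsnD).check G.toS2.fs.base.a G.toS2.fs.base.b G.toS2.fs.base.c &&
    decide (0 < MonicCubic.disc ccr.cc.A ccr.cc.B ccr.cc.C) &&
    decide (normFormZ G.toS2.fs.base.a G.toS2.fs.base.b G.toS2.fs.base.c ccr.cc.XD.1 ccr.cc.XD.2.1
      ccr.cc.XD.2.2 ≠ 0) &&
    decide ((normFormZ G.toS2.fs.base.a G.toS2.fs.base.b G.toS2.fs.base.c ccr.cc.XD.1 ccr.cc.XD.2.1
      ccr.cc.XD.2.2).natAbs = (ccr.cc.dn.map fun pe => pe.1 ^ pe.2).prod) &&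
    (ccr.cc.dn.all fun pe => primeDispatchS G.toS2 ccr.cc (fracOf G.toS2 ccr.cc.XD ccr.cc.tsnD) ccr.cc.XD
      ccr.cc.dinvA ccr.cc.dmiss2 pe.1) &&
    (ccr.cc.codes.all fun bc => codeClauseS G.toS2 ccr.cc bc) &&
    invCert G.toS2.fs.base.a G.toS2.fs.base.b G.toS2.fs.base.c G.toS2.fs.base.w₁ ccr.cc.XD ccr.cc.dW1 &&
    invCert G.toS2.fs.base.a G.toS2.fs.base.b G.toS2.fs.base.c G.toS2.fs.base.w₂ ccr.cc.XD ccr.cc.dW2 &&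
    (ccr.cc.Q.all fun q => decide (0 < q)) &&
    decide (ccr.cc.head.length = 5) &&
    ((famS ccr.cc).all fun f => famCheckSR G ccr f) &&
    (linLtCond (G.fr.I ccr.o₀).1 (G.fr.I ccr.o₀).2 (G.fr.I ccr.o₁).1 (G.fr.I ccr.o₁).2 ccr.cc.Xt &&
      linLtCond (G.fr.I ccr.o₁).1 (G.fr.I ccr.o₁).2 (G.fr.I ccr.o₂).1 (G.fr.I ccr.o₂).2 ccr.cc.Xt) &&
    decide (∀ T : Finset (Fin (famS ccr.cc).length), T ≠ ∅ →
      ∃ k : Fin (G.toS2.fs.base.chars.length + 5), Odd (T.filter fun j => bitRS G ccr k j = true).card) &&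
    decide (((Finset.univ ×ˢ Finset.univ).filter
      (fun p : Finset (Fin 0) × Finset (Fin (famS ccr.cc).length) => admRS G ccr p.1 p.2 = true)).card ≤ 2 ^ r)

end Checkers

/-! ## Soundness: entry-level real-place lemmas -/

section Sound

variable {K : Type*} [Field K] [NumberField K] {θ : K} {F : ClFieldCertS2}

/-- **Sign of a fractional element at a real place from an interval sign clause on `X`** (`true` = negative):
`ρ(X) = m₁·ρ(x)` with `m₁ > 0`. [folklore] -/
theorem sign_iff_eltS_of_signCond (hθ : aeval θ (MonicCubic.poly F.fs.base.a F.fs.base.b F.fs.base.c) = 0)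
    (ρ : K →+* ℝ) {lo hi : ℚ} (h0 : 0 ≤ lo) (hlo : ((lo : ℚ) : ℝ) < ρ θ) (hhi : ρ θ < ((hi : ℚ) : ℝ))
    (hK : F.checkConst = true) {X tsn : ℤ × ℤ × ℤ}
    (hx : (fracOf F X tsn).check F.fs.base.a F.fs.base.b F.fs.base.c = true) {sg : Bool}
    (h : signCond lo hi X sg = true) :
    (sg = true ↔ ρ (algebraMap (𝓞 K) K ((fracOf F X tsn).toInt hθ hx)) < 0) := by
  have h1 := sign_iff_of_signCond hθ ρ h0 hlo hhi h
  rw [rho_eltS hθ hx ρ] at h1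
  have hm : (0 : ℝ) < F.m₁ := Nat.cast_pos.mpr (F.m₁_pos hK)
  rw [h1]
  constructor
  · intro hneg
    by_contra hc
    push Not at hc
    nlinarith
  · intro hneg
    exact mul_neg_of_pos_of_neg hm hneg

/-- A fractional element with an interval sign clause does not vanish at the place. [folklore] -/
theorem rho_eltS_ne_zero_of_signCond (hθ : aeval θ (MonicCubic.poly F.fs.base.a F.fs.base.b F.fs.base.c) = 0)
    (ρ : K →+* ℝ) {lo hi : ℚ} (h0 : 0 ≤ lo) (hlo : ((lo : ℚ) : ℝ) < ρ θ) (hhi : ρ θ < ((hi : ℚ) : ℝ))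
    {X tsn : ℤ × ℤ × ℤ} (hx : (fracOf F X tsn).check F.fs.base.a F.fs.base.b F.fs.base.c = true) {sg : Bool}
    (h : signCond lo hi X sg = true) : ρ (algebraMap (𝓞 K) K ((fracOf F X tsn).toInt hθ hx)) ≠ 0 := by
  have h1 := rho_lin_ne_zero_of_signCond hθ ρ h0 hlo hhi h
  rw [rho_eltS hθ hx ρ] at h1
  exact (mul_ne_zero_iff.mp h1).2

variable {G : ClFieldCertRS2} {ccr : ClCurveCertSR} {f : FamEntryS}

/-- The complex clause of a checked entry. -/
theorem famCheckS_of_famCheckSR (h : famCheckSR G ccr f = true) : famCheckS G.toS2 ccr.cc f = true := by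
  simp only [famCheckSR, Bool.and_eq_true] at h
  exact h.1.1

/-- **Sign bits at the three places** of a checked entry (`true` = negative). [folklore] -/
theorem sgAtS_iff_of_famCheckSR
    (hθ : aeval θ (MonicCubic.poly G.toS2.fs.base.a G.toS2.fs.base.b G.toS2.fs.base.c) = 0)
    (ρ : Fin 3 → (K →+* ℝ)) (h0 : ∀ k, 0 ≤ (G.fr.I k).1)
    (hρ : ∀ k, (((G.fr.I k).1 : ℚ) : ℝ) < ρ k θ ∧ ρ k θ < (((G.fr.I k).2 : ℚ) : ℝ))
    (hK : G.toS2.checkConst = true) (h : famCheckSR G ccr f = true) (k : Fin 3) :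
    (sgAtS ccr f k = true ↔ ρ k (algebraMap (𝓞 K) K
      ((fracOf G.toS2 f.X f.tsn).toInt hθ (frac_of_famCheckS (famCheckS_of_famCheckSR h)))) < 0) := by
  have h1 := signCond_of_famCheckS (famCheckS_of_famCheckSR h)
  have hx := frac_of_famCheckS (famCheckS_of_famCheckSR h)
  have h' := h
  simp only [famCheckSR, Bool.and_eq_true] at h'
  obtain ⟨⟨-, h2⟩, h3⟩ := h'
  have hk0 := h0 k
  obtain ⟨hlo, hhi⟩ := hρ k
  fin_cases k <;> simp only [ClFieldCertR.I, sgAtS, Fin.isValue, Fin.zero_eta, Fin.mk_one, Fin.reduceFinMk,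
    ↓reduceIte, Fin.reduceEq] at hk0 hlo hhi ⊢
  · exact sign_iff_eltS_of_signCond hθ _ hk0 hlo hhi hK hx h1
  · exact sign_iff_eltS_of_signCond hθ _ hk0 hlo hhi hK hx h2
  · exact sign_iff_eltS_of_signCond hθ _ hk0 hlo hhi hK hx h3

/-- A checked entry does not vanish at any place. [folklore] -/
theorem rho_ne_zero_of_famCheckSR
    (hθ : aeval θ (MonicCubic.poly G.toS2.fs.base.a G.toS2.fs.base.b G.toS2.fs.base.c) = 0)
    (ρ : Fin 3 → (K →+* ℝ)) (h0 : ∀ k, 0 ≤ (G.fr.I k).1)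
    (hρ : ∀ k, (((G.fr.I k).1 : ℚ) : ℝ) < ρ k θ ∧ ρ k θ < (((G.fr.I k).2 : ℚ) : ℝ))
    (h : famCheckSR G ccr f = true) (k : Fin 3) :
    ρ k (algebraMap (𝓞 K) K
      ((fracOf G.toS2 f.X f.tsn).toInt hθ (frac_of_famCheckS (famCheckS_of_famCheckSR h)))) ≠ 0 := by
  have h1 := signCond_of_famCheckS (famCheckS_of_famCheckSR h)
  have hx := frac_of_famCheckS (famCheckS_of_famCheckSR h)
  have h' := h
  simp only [famCheckSR, Bool.and_eq_true] at h'
  obtain ⟨⟨-, h2⟩, h3⟩ := h'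
  have hk0 := h0 k
  obtain ⟨hlo, hhi⟩ := hρ k
  fin_cases k <;> simp only [ClFieldCertR.I, Fin.isValue, Fin.zero_eta, Fin.mk_one, Fin.reduceFinMk,
    ↓reduceIte, Fin.reduceEq] at hk0 hlo hhi ⊢
  · exact rho_eltS_ne_zero_of_signCond hθ _ hk0 hlo hhi hx h1
  · exact rho_eltS_ne_zero_of_signCond hθ _ hk0 hlo hhi hx h2
  · exact rho_eltS_ne_zero_of_signCond hθ _ hk0 hlo hhi hx h3

end Sound

end Summit.BirchSwinnertonDyer.BirchSwinnertonDyer.Rank2Observatory.TwoDescCl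

end
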